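import Literature.AlgebraicGeometry.ModuliOfAbelianVarieties.SiegelReciprocityPrincipalIdele
import Literature.AlgebraicGeometry.ModuliOfAbelianVarieties.SiegelModuliInterpretation
import HarnessLib

/-!
# The reciprocity element of a CM special pair commutes with the CM action
# ([Deligne 1971] 3.9 ∕ 4.18: `r(T, μ)(s) ∈ T(𝔸_f)`, `T = Res F^×` inside the commutant of `F`; [Milne 2005] Def. 12.8 (60)–(61), Thm. 11.2)

Topic `AlgebraicGeometry/ModuliOfAbelianVarieties`; namespace `Literature.AlgebraicGeometry.ModuliOfAbelianVarieties.CMStructure`.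
THEOREMS ONLY (no definition, no named fact, no instance, no notation, no `sorry`; net Literature debt 0).  Sequel of ★ R60-1
`SiegelCMReciprocitySimilitude` (`cmRepMatrix_mul`: the action of `F ⊗ 𝔸_{ℚ,f}` on `𝔸_{ℚ,f}^{2g}` is multiplicative) and ★ R60-26
`SiegelReciprocityPrincipalIdele` (`cmRepMatrix_algebraMap`: a principal tuple acts by its rational matrix).  Cell `hodgecm-mathlib` (D-0151),
FLOOR 0, P6 E-line socket `stub_E6`, Σ-GAL half — the **(K-b)∕(K-c) junction** of the kernel assembly: the organ ★ (K-b)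
`SiegelConjugationHomReindex` ∕ `F0P6aCMHomKernelShape` factors the re-indexing element of the E6-γ kernel as `g₀ = r_cm` (matrix
`c.cmRecipMatrix Φ E s`), and the organ ★ (K-c) `SiegelAdelicCongrFrameTransport.adelicCongr_mulVec_of_frame` needs `hlin : g₀ · ρ_𝔸 = ρ_𝔸 · g₀`
for the adelised rational reading `ρ` of the `𝒪_F`-action — which, once the CM structure is pinned on the frame (`ρ(b) = c.actMatrix (b, …, b)`),
is THIS file: **the reciprocity element commutes with `actMatrix`** because `F ⊗ 𝔸_f = ∏ᵢ 𝔸_{Kᵢ,f}` is commutative and acts through the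
ring homomorphism `cmRepMatrix` extending `actMatrix`.  `--supports stmt-HodgeConjecture-24832`, count-neutral; HC_CM is proved only modulo the printed
citations (2 remaining named inputs hLiu418 24832, h413 24833) until rung 0 closes.

* `cmRepMatrix_comm` — `R(t) R(t′) = R(t′) R(t)`;
* `cmRepMatrix_mul_actMatrix_map_comm` — `R(t) · act(x)_𝔸 = act(x)_𝔸 · R(t)`;
* `cmRecipMatrix_mul_actMatrix_map_comm`, `cmRecipMatrix_mul_adelicMatrix_actMatrix_comm` — the same for `r_cm = c.cmRecipMatrix Φ E s`
  (the second in the `adelicMatrix` spelling of ★ T1′ `SiegelModuliInterpretation`, the literal currency of (K-c)'s `hlin`);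
* `coe_mul_adelicMatrix_actMatrix_comm_of_coe_eq_cmRecipMatrix` — for `r ∈ GSp_δ(𝔸_f)` with matrix `c.cmRecipMatrix Φ E s` (the `hr` binder
  of ★ `CMConjugationIsogenyAll` ∕ ★ `SiegelRationalModel.IsCanonical`).

## References
* [Deligne1971TravauxShimura] P. Deligne, *Travaux de Shimura* (1971), 3.9 p. 140, 4.18 p. 150.
* [Milne2005ShimuraVarieties] J. S. Milne, *Introduction to Shimura varieties* (2005), Def. 12.8 (60)–(62) p. 114, §11 Thm. 11.2 p. 108 (`E`-linear `α`).
-/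

set_option autoImplicit false

noncomputable section

open Matrix NumberField IsDedekindDomain

namespace Literature.AlgebraicGeometry.ModuliOfAbelianVarieties

namespace CMStructure

variable {g : ℕ} {δ : Fin g → ℕ} {ι : Type} [Fintype ι] [DecidableEq ι] {K : ι → Type} [∀ i, Field (K i)]
  [∀ i, NumberField (K i)] [∀ i, IsCMField (K i)] (c : CMStructure g δ ι K)

/-- **`F ⊗ 𝔸_{ℚ,f}` acts commutatively**: `R(t) R(t′) = R(t t′) = R(t′ t) = R(t′) R(t)` (★ `cmRepMatrix_mul`; `∏ᵢ 𝔸_{Kᵢ,f}` is commutative).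
[cite: Deligne1971TravauxShimura, 3.9 p. 140 and 4.18 p. 150] -/
theorem cmRepMatrix_comm (t t' : Π i, FiniteAdeleRing (𝓞 (K i)) (K i)) :
    c.cmRepMatrix t * c.cmRepMatrix t' = c.cmRepMatrix t' * c.cmRepMatrix t := by
  rw [← cmRepMatrix_mul, ← cmRepMatrix_mul, mul_comm]

/-- **The adelic action commutes with the rational action**: `R(t) · act(x)_𝔸 = act(x)_𝔸 · R(t)` for `t ∈ ∏ᵢ 𝔸_{Kᵢ,f}`, `x ∈ F = ∏ᵢ Kᵢ`
(`act(x)_𝔸 = R(x̂)`, ★ `cmRepMatrix_algebraMap`). [cite: Deligne1971TravauxShimura, 3.9 p. 140 and 4.18 p. 150] -/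
theorem cmRepMatrix_mul_actMatrix_map_comm (t : Π i, FiniteAdeleRing (𝓞 (K i)) (K i)) (x : Π i, K i) :
    c.cmRepMatrix t * (c.actMatrix x).map (algebraMap ℚ finAdeleQ) =
      (c.actMatrix x).map (algebraMap ℚ finAdeleQ) * c.cmRepMatrix t := by
  rw [← cmRepMatrix_algebraMap, cmRepMatrix_comm]

variable (Φ : ∀ i, Motives.CMType (K i)) (E : IntermediateField ℚ ℂ) [NumberField ↥E]

/-- **THE RECIPROCITY ELEMENT COMMUTES WITH THE CM ACTION**: `r_cm · act(x)_𝔸 = act(x)_𝔸 · r_cm` for `r_cm = c.cmRecipMatrix Φ E s` (the tuple of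
reflex norms of `s` acting through `act`: [Milne2005ShimuraVarieties] Def. 12.8 (60)–(61), `r(T, μ)(s) ∈ T(𝔸_f)`; the `F`-linearity of the CM isogeny of
Thm. 11.2 read on adelic coordinates). [cite: Milne2005ShimuraVarieties, Def. 12.8 (60)–(61) p. 114 and §11 Thm. 11.2 p. 108] [cite: Deligne1971TravauxShimura, 4.18 p. 150] -/
theorem cmRecipMatrix_mul_actMatrix_map_comm (s : (FiniteAdeleRing (𝓞 ↥E) ↥E)ˣ) (x : Π i, K i) :
    c.cmRecipMatrix Φ E s * (c.actMatrix x).map (algebraMap ℚ finAdeleQ) =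
      (c.actMatrix x).map (algebraMap ℚ finAdeleQ) * c.cmRecipMatrix Φ E s :=
  c.cmRepMatrix_mul_actMatrix_map_comm _ x

/-- The same in the `adelicMatrix` spelling of ★ T1′ (`adelicMatrix M = M.map (algebraMap ℚ 𝔸_{ℚ,f})`): `r_cm · (act x)^ = (act x)^ · r_cm` — the
`hlin` operand of ★ (K-c) `adelicCongr_mulVec_of_frame` once `g₀ = r_cm` (★ (K-b) `mover_mul_reindex_mul_mover_inv_eq`) and `ρ = act(x)`.
[cite: Milne2005ShimuraVarieties, Def. 12.8 (60)–(61) p. 114 and §11 Thm. 11.2 p. 108] -/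
theorem cmRecipMatrix_mul_adelicMatrix_actMatrix_comm (s : (FiniteAdeleRing (𝓞 ↥E) ↥E)ˣ) (x : Π i, K i) :
    c.cmRecipMatrix Φ E s * adelicMatrix (c.actMatrix x) = adelicMatrix (c.actMatrix x) * c.cmRecipMatrix Φ E s :=
  c.cmRecipMatrix_mul_actMatrix_map_comm Φ E s x

/-- **For an element `r ∈ GSp_δ(𝔸_f)` OF MATRIX `c.cmRecipMatrix Φ E s`** (the `hr` binder of ★ `MumfordModuli.CMConjugationIsogenyAll` ∕ ★
`SiegelRationalModel.IsCanonical`): `r · (act x)^ = (act x)^ · r`. [cite: Milne2005ShimuraVarieties, Def. 12.8 (60)–(62) p. 114] -/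
theorem coe_mul_adelicMatrix_actMatrix_comm_of_coe_eq_cmRecipMatrix (s : (FiniteAdeleRing (𝓞 ↥E) ↥E)ˣ) {r : ↥(gspFinAdelic δ)}
    (hr : ((r : GL (Fin g ⊕ Fin g) (FiniteAdeleRing (𝓞 ℚ) ℚ)) :
      Matrix (Fin g ⊕ Fin g) (Fin g ⊕ Fin g) (FiniteAdeleRing (𝓞 ℚ) ℚ)) = c.cmRecipMatrix Φ E s) (x : Π i, K i) :
    ((r : GL (Fin g ⊕ Fin g) finAdeleQ) : Matrix (Fin g ⊕ Fin g) (Fin g ⊕ Fin g) finAdeleQ) * adelicMatrix (c.actMatrix x) =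
      adelicMatrix (c.actMatrix x) * ((r : GL (Fin g ⊕ Fin g) finAdeleQ) : Matrix (Fin g ⊕ Fin g) (Fin g ⊕ Fin g) finAdeleQ) := by
  have h : ((r : GL (Fin g ⊕ Fin g) finAdeleQ) : Matrix (Fin g ⊕ Fin g) (Fin g ⊕ Fin g) finAdeleQ) = c.cmRecipMatrix Φ E s := hr
  rw [h]
  exact c.cmRecipMatrix_mul_adelicMatrix_actMatrix_comm Φ E s x

end CMStructure

end Literature.AlgebraicGeometry.ModuliOfAbelianVarieties

end
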